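import Mathlib
import HarnessLib
import Summits.HubbardSuperconductivity.HubbardSuperconductivity.Theorems.KLProgrammeKLRegimeSplitPredicates
import Summits.HubbardSuperconductivity.HubbardSuperconductivity.Theorems.KLProgrammeKLRegimeSplitGeneric

/-!
# Route `KLProgramme` — crux K3 `KLRegimeTwoPointLimit` (stmt-HubbardSuperconductivity-19937): the AMENDED per-scale
# predicates `EngineBoundsAtV2` (child 3's output) and `BetaSplitAtV2` (child 1's output) of the glued split, over
# NON-VACUOUS momentum-space carriers, with the supplier map (cell gate-hubbard-kl, seat p1 = C1 lead, g5)

WHY A V2 (HOME/STATUS 2026-08-26T09:21:49Z, director 09:23:36Z HOLD, planner g9 09:31:42Z contract (C-i)–(C-v)).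
(A) `klIsoArray ≡ 0` below the ultraviolet scale (kernel-checked: `KLProgrammeLegKernels.klIsoArray_eq_zero`,
`…_bare_frame`, module `KLProgrammeKLRegimeTwoPointLimitIsoArrayVanishing`, p433957): the lab-frame position sum forces the
integrated legs to the band bottom, outside every infrared multiplier; hence v1's (B3) `NonCooperFrozen` and (E2′) `IsoIncrements`
compare `0` with `0`.  (B) The v1 Cooper data are SPECTRAL (bottoms/tops of five `D₄` blocks of the weighted localised matrix);
`norm_le_of_envelopes` turns them into an OPERATOR norm, which bounds entries only up to `1/√(w_s w_t) ≍ 4ⁿ/W` — but the endpoint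
norm line (B2) = BGM (2.71a), the one line the engine consumes, is VALUE-level.  As landed, (B2) had no supplier in any child.

WHAT CHANGES (everything else of `…SplitPredicates` is kept verbatim and re-used by name):
* ARRAYS ARE MOMENTUM-SPACE VALUES (planner (C-ii)).  `klPairAmplitude … n Q k k'` = the scale-`n` four-point vertex function
  `𝒱₄` (`vertexFn`, Salmhofer's normalisation, bare value `+U`) of the pair `(k↑, Q-k↓) → (k'↑, Q-k'↓)` at the lowest Matsubara
  frequencies `(ω₀, -ω₀)` and total lattice momentum `Q` — at `Q = 0` it is D1's `klCooperAmplitude` (same label tuple); the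
  PAIR CLASS at resolution `n` is `|p_Q|_𝕋 ≤ 4^{-n}` (`IsPairClassAt`, D1's `IsCooperClassAt` read on `Q`).  Values are taken
  for ALL lattice momenta of the ultraviolet ball `klShell … 0` (the scale-`n` action is a polynomial in all fields; the exact
  ladder `𝒞₀(1 + 𝔅_n𝒞₀)⁻¹` is `k`-independent to leading order everywhere, so no sector-grid transport is ever needed).
* (E2-v2) `PairLadderStepAt` — the engine's ONE-STEP LADDER IDENTITY WITH REMAINDER at the array level: at `n ≥ 1`, for every
  pair-class `Q`, there are slice bubble weights `w ≥ 0` of mass `≤ bhi` and an inverse witness `N` of `1 + diag(w)·A`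
  (`A` = the scale-`(n-1)` array at `Q`, truncated to the ball) with `|𝒞_n(Q;k,k') − (A·N)(k,k')| ≤ drivePBar(n-1) + ē_{n-1}`
  (SOURCE-indexed, planner's Δ6 ruling); at `n = 0` the ultraviolet clause `|𝒞₀(Q;k,k') − U| ≤ initDevBar`.  This replaces
  v1's scalar `CooperCascadeStep` for the K3 chain (the block clauses stay available in `klPreds` for the onset programme).
* (E2″-v2) `PairValueIncrementAt` — per-scale VALUE increments of the pair arrays at EVERY total momentum `Q` and all momenta of
  the ball, bounded by `(Klam U)²` times the two-shell gains at the configuration's transfers `(Q, k−k', k+k'−Q)` plus `ē_{n-1}`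
  (Lemma E.1/E.3); for `Q` outside the pair class these are summable (frozen data).
* (E2′-v2) `TupleIncrementL1At` — the per-scale INCREMENT of the quartic kernel in the fixed-tuple `L¹` norm, sectorised at
  EVERY resolution `m ≥ n` (isotropic AND anisotropic tuples of BGM's conservation sets), bounded by `(Klam U)²` times the
  two-shell gains at the tuple's own transfers plus `ē_{n-1}`; both actions are elements of the same `HubbardGrassmann L M`, so
  `klEffectiveAction n − klEffectiveAction (n-1)` is an honest Grassmann difference.  Replaces `IsoIncrements`; (B3) is DROPPED
  (child 1 re-sums the history's increments directly).
* (E5-v2) `CooperTupleL1At` — VALUES ⇒ `L¹` on pair-class tuples (implication form): if the scale-`n` pair array is bounded by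
  `B` on the ball, the fixed-tuple `L¹` norm of the scale-`n` quartic kernel on every tuple of resolution `m ≥ n` whose
  particle–particle transfer is pair-class at resolution `n` is `≤ CF·B + CF·(Klam U)²` (off-shell/other-frequency values and
  the tangential/`Q`-smoothness at the sector scale are summable sign-blind over the scales above `n`; the tree expansion's decay).
* (B1-v2) `PairArrayAt` — child 1's Cooper datum: for every pair-class `Q` there is a running s-wave value `u ∈ [0, 2|U|]` with
  `|𝒞_n(Q;k,k') − u| ≤ C_W·U²` on the ball (weighted max-entry form; resummation by Sherman–Morrison for the repulsive rank-one
  part — denominator `≥ 1` BECAUSE `U ≥ 0` — and Neumann for the rest, `B_n·W·C_W U² ≤ c·C_W ln 4 ≤ 1/3` in the leaf's small-`c`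
  regime: `KLProgrammeCooperResummation.klcr_resummed_entry_le`, p436217).  Replaces v1's (B1) block envelopes for the K3 chain.

SUPPLIER MAP (planner (C-i); «X(n) ⇐ Y» = the prover of the child concluding X at scale `n` uses exactly Y):
| consumer clause                                  | supplier clauses                                                                 | work     |
|--------------------------------------------------|----------------------------------------------------------------------------------|----------|
| (B1-v2) `PairArrayAt n`, `Q` pair-class at `n`     | (E2-v2) `PairLadderStepAt j`, `j ≤ n` (n = 0: UV clause; steps resummed)          | child 1: Sherman–Morrison/Neumann in `|||·|||` (p436217 + its Lipschitz form) |
| (B1-v2) `PairArrayAt n`, `Q` exited at `t < n`     | (B1-v2) `PairArrayAt t` (Hist) + (E2″-v2) `PairValueIncrementAt j`, `j ∈ (t, n]`, `Σ_{j>t} ppGain j |Q| ≤ CF` (`G.WF`) | child 1: a sum |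
| (B2) `EndpointNormLine n`, tuple NOT pair-class at any `t ≤ n` | (E2′-v2) `TupleIncrementL1At j` at resolution `m = n`, `j ≤ n`, + `G.WF` gain summability (E.1/E.3) | child 1: a sum |
| (B2) `EndpointNormLine n`, tuple pair-class down to `t ≤ n`, exited at `t+1` (or `t = n`) | (B1-v2) `PairArrayAt t` (Hist or just proved) ⇒ (E5-v2) `CooperTupleL1At t` with `B = 2|U| + C_W U²`, + (E2′-v2) `j ∈ (t, n]` with `Σ_{j>t} ppGain j q ≤ CF` (`G.WF`) | child 1: a sum |
| (B4) `FirstMoments n`                            | (E4) `EngineFirstMoments n` (`P.Cd ≥ G.cE4 + 1`, `Q.cE4·U₀ ≤ 1`)                    | child 1: one line |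
| (E0) (E1) (E2-v2) (E2″-v2) (E2′-v2) (E4) (E5-v2) at `n` | `HistP`: (B2)(j<n) sizes, `RenormalisedAt`(j<n), (B4)(j<n) moments; (B1-v2)(n-1) only NAMES the array `A` | child 3: the tree expansion at scale `n` |
Nothing in the K3 chain depends on «envelope ⇒ value» (planner (C-iii)); `TwoLegStep`, `RenormalisedAt`, `FrameOK` are untouched.

Definitions with bodies only (statements-first); nothing is asserted about the model.  The bundle `klPredsV2 : Preds` and the glue
line `KLRegimeInductionV2 := KLRegimeInductionP klPredsV2` are ONE def + ONE line for the module owner (p2) / the split filer (plan).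
References: HOME/STATUS 09:21:49Z (p1), 09:31:42Z (plan g9 contract), 11:40:30Z-stamped (p2 structural answer); HOME/p1/ENGINE-PRED.md;
BGM 2006 §2.7 (2.70)–(2.71), §3 (3.65)–(3.67); J. Sherman, W. J. Morrison, Ann. Math. Stat. 21 (1950) 124.
-/

noncomputable section

namespace Summit.HubbardSuperconductivity.HubbardSuperconductivity.Theorems.KLRegimeSplit

set_option linter.dupNamespace false -- summit = problem name (single-conjunct summit), D-0017

open Real Finset Literature.MathematicalPhysics.QuantumLattice Literature.Probability.LatticeModels
open Summit.HubbardSuperconductivity.HubbardSuperconductivity.Theorems.KLProgrammeLegKernels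
open Summit.HubbardSuperconductivity.HubbardSuperconductivity.Theorems.CooperChannelRiccatiFlow

/-! ## §1 Momentum-space carriers (non-vacuous by construction: values of `vertexFn`, bare value `+U`) -/

section Model

variable (L M : ℕ) [NeZero L] [NeZero M]

/-- **The pair amplitude of the scale-`n` action at total lattice momentum `Q`**:
`𝒞_n(Q; k⃗, k⃗') = 𝒱₄(ψ̂⁺_{(ω₀,k⃗')↑}, ψ̂⁺_{(-ω₀,Q-k⃗')↓}, ψ̂⁻_{(-ω₀,Q-k⃗)↓}, ψ̂⁻_{(ω₀,k⃗)↑})` — the pair `(k⃗↑, Q-k⃗↓) → (k⃗'↑, Q-k⃗'↓)`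
at the lowest Matsubara frequencies (`vertexFn`; bare value `+U` for every `Q, k⃗, k⃗'`).  At `Q = 0` this is D1's
`klCooperAmplitude … n k k'` (same label tuple, `0 - k⃗' = -k⃗'`). -/
def klPairAmplitude (β U μ : ℝ) (K : TrigPolyC4v) (n : ℕ) (Q k k' : TorusSite 2 L) : ℂ :=
  vertexFn L M β (klEffectiveAction L M β U μ K klE0 n) 4
    ![(((omega0 M, k'), 0), 0), ((((omega0 M).rev, Q - k'), 1), 0), ((((omega0 M).rev, Q - k), 1), 1),
      (((omega0 M, k), 0), 1)]

/-- **The pair class at resolution `n`**: the total lattice momentum `Q` is within `4^{-n}` of `2πℤ²` in the torus sup-distance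
(`|p_Q|_𝕋 ≤ 4^{-n}`; umklapp pairs included, as in D1's `IsCooperClassAt`). -/
def IsPairClassAt (Q : TorusSite 2 L) (n : ℕ) : Prop :=
  torusSupNorm (latticeMomentum L Q 0, latticeMomentum L Q 1) ≤ ((4 : ℝ) ^ n)⁻¹

/-- The ultraviolet ball `S₀ = {k⃗ : |e_K(k⃗)| ≤ Λ₀}` of the frame band — the momenta at which the arrays are read at EVERY
scale (`klShell … 0`). -/
def klBall (μ : ℝ) (K : TrigPolyC4v) : Finset (TorusSite 2 L) := klShell L μ K 0

/-- **The scale-`n` pair array at total momentum `Q`, truncated to the ball** (zero outside `S₀ × S₀`), as a matrix on the torus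
carrier — the object the one-step ladder identity (E2-v2) resums. -/
def klPairArray (β U μ : ℝ) (K : TrigPolyC4v) (n : ℕ) (Q : TorusSite 2 L) : Matrix (TorusSite 2 L) (TorusSite 2 L) ℂ :=
  Matrix.of fun k k' => if k ∈ klBall L μ K ∧ k' ∈ klBall L μ K then klPairAmplitude L M β U μ K n Q k k' else 0

/-- **The sectorised INCREMENT kernels between scales `n - 1` and `n`, isotropic resolution `m`**: the `4`-leg sectorised
position-space kernels of the Grassmann difference `𝒱_n - 𝒱_{n-1}` (both are elements of `HubbardGrassmann L M`) with the
scale-`m` isotropic multipliers on the legs; at `n = 0` the kernels of `𝒱₀` itself. -/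
def klIsoIncrementKernel (β U μ : ℝ) (K : TrigPolyC4v) (n m : ℕ) :
    (Fin 4 → SectorLeg (sectorCount (2 * m))) → (Fin 4 → SpaceTimeIdx L M) → ℂ :=
  sectorisedKernel L M β (klIsoFamily L M β μ K klE0 m)
    (klEffectiveAction L M β U μ K klE0 n - if n = 0 then 0 else klEffectiveAction L M β U μ K klE0 (n - 1)) 4

/-- The same with the scale-`m` ANISOTROPIC multipliers on the legs ((2.71b)'s tuples). -/
def klAnisoIncrementKernel (β U μ : ℝ) (K : TrigPolyC4v) (n m : ℕ) :
    (Fin 4 → SectorLeg (sectorCount m)) → (Fin 4 → SpaceTimeIdx L M) → ℂ :=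
  sectorisedKernel L M β (klAnisoFamily L M β μ K klE0 m)
    (klEffectiveAction L M β U μ K klE0 n - if n = 0 then 0 else klEffectiveAction L M β U μ K klE0 (n - 1)) 4

/-- The scale-`n` quartic kernel sectorised at isotropic resolution `m` (for `m = n` this is D1's `klLegKernel … n 4`). -/
def klIsoKernelAt (β U μ : ℝ) (K : TrigPolyC4v) (n m : ℕ) :
    (Fin 4 → SectorLeg (sectorCount (2 * m))) → (Fin 4 → SpaceTimeIdx L M) → ℂ :=
  sectorisedKernel L M β (klIsoFamily L M β μ K klE0 m) (klEffectiveAction L M β U μ K klE0 n) 4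

/-- The scale-`n` quartic kernel sectorised at anisotropic resolution `m` (for `m = n`: D1's `klAnisoLegKernel … n 4`). -/
def klAnisoKernelAt (β U μ : ℝ) (K : TrigPolyC4v) (n m : ℕ) :
    (Fin 4 → SectorLeg (sectorCount m)) → (Fin 4 → SpaceTimeIdx L M) → ℂ :=
  sectorisedKernel L M β (klAnisoFamily L M β μ K klE0 m) (klEffectiveAction L M β U μ K klE0 n) 4

end Model

/-! ### Anisotropic transfers (the isotropic ones are D1's `klPPTransfer` / `klPHTransferDirect` / `klPHTransferExchange`) -/

/-- The sector-centre momentum on the free Fermi curve of the ANISOTROPIC sector `ω` at index `m` (`sectorCount m` sectors). -/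
def klAnisoSectorMomentum (μ : ℝ) (m : ℕ) (ω : Fin (sectorCount m)) : ℝ × ℝ :=
  (bandX μ (sectorCenter m ω), bandY μ (sectorCenter m ω))

/-- The particle–particle transfer of an ordered anisotropic 4-tuple (legs `1`, `3`). -/
def klAnisoPPTransfer (μ : ℝ) (m : ℕ) (Ω : Fin 4 → SectorLeg (sectorCount m)) : ℝ × ℝ :=
  klAnisoSectorMomentum μ m (Ω 1).1.1 + klAnisoSectorMomentum μ m (Ω 3).1.1

/-- The direct particle–hole transfer of an ordered anisotropic 4-tuple (legs `0`, `1`). -/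
def klAnisoPHTransferDirect (μ : ℝ) (m : ℕ) (Ω : Fin 4 → SectorLeg (sectorCount m)) : ℝ × ℝ :=
  klAnisoSectorMomentum μ m (Ω 0).1.1 - klAnisoSectorMomentum μ m (Ω 1).1.1

/-- The exchange particle–hole transfer of an ordered anisotropic 4-tuple (legs `0`, `3`). -/
def klAnisoPHTransferExchange (μ : ℝ) (m : ℕ) (Ω : Fin 4 → SectorLeg (sectorCount m)) : ℝ × ℝ :=
  klAnisoSectorMomentum μ m (Ω 0).1.1 - klAnisoSectorMomentum μ m (Ω 3).1.1

/-! ## §2 New majorants (closed forms in the landed constant packages `G`, `P`, `Q`) -/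

/-- **The ultraviolet deviation budget** of the scale-`0` pair arrays from the bare value `+U`: `(Σ_χ (abot χ + atop χ) + 1)·U²`
(re-uses v1's initial block data fields of `G`; every second-order ultraviolet constant fits). -/
def initDevBar (G : GeoConsts) (U : ℝ) : ℝ := (∑ χ : D4Irrep, (G.abot χ + G.atop χ) + 1) * U ^ 2

/-- **The gain majorant of an increment** at scale `n` and transfers of torus size `(ρpp, ρd, ρx)`:
`(Klam U)²·(ppGain n ρpp + phGain n ρd + phGain n ρx)`. -/
def gainBar (G : GeoConsts) (P : SplitConsts) (U : ℝ) (n : ℕ) (ρpp ρd ρx : ℝ) : ℝ :=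
  (P.Klam * U) ^ 2 * (G.ppGain n ρpp + G.phGain n ρd + G.phGain n ρx)

/-- **The ultraviolet `L¹` budget** of the scale-`0` quartic kernel on a fixed tuple: `CF·|U|·(1 + Klam²|U|)` (bare vertex `C_F|U|`
plus second order). -/
def initL1Bar (G : GeoConsts) (P : SplitConsts) (U : ℝ) : ℝ := G.CF * |U| * (1 + P.Klam ^ 2 * |U|)

/-! ## §3 The amended ENGINE clauses -/

section Model

variable (L M : ℕ) [NeZero L] [NeZero M]

/-- **(E2-v2) the one-step ladder identity with remainder, array level.**  At `n = 0` (ultraviolet clause): every pair-class-`0`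
array entry on the ball is within `initDevBar` of the bare `+U`.  At `n ≥ 1`: for every `Q` in the pair class at resolution `n`
there are slice bubble weights `w ≥ 0` of total mass `≤ bhi` and an inverse witness `N` with `(1 + diag(w)·A)·N = 1`,
`A = klPairArray … (n-1) Q`, such that on the ball `|𝒞_n(Q;k,k') − (A·N)(k,k')| ≤ drivePBar (n-1) + ē_{n-1}` (source-indexed:
the step `n-1 → n` is charged to `n-1`).  `A·N = A(1 + diag(w)A)⁻¹` is C2's cascade `x ↦ x/(1 + b x)` at the array level. -/
def PairLadderStepAt (G : GeoConsts) (P : SplitConsts) (Q : EngConsts) (β U μ : ℝ) (K : TrigPolyC4v) (n : ℕ) : Prop :=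
  (n = 0 → ∀ Qm : TorusSite 2 L, IsPairClassAt L Qm 0 → ∀ k ∈ klBall L μ K, ∀ k' ∈ klBall L μ K,
      ‖klPairAmplitude L M β U μ K 0 Qm k k' - (U : ℂ)‖ ≤ initDevBar G U) ∧
  (1 ≤ n → ∀ Qm : TorusSite 2 L, IsPairClassAt L Qm n →
      ∃ w : TorusSite 2 L → ℝ, (∀ p, 0 ≤ w p) ∧ (∑ p, w p ≤ G.bhi) ∧
        ∃ N : Matrix (TorusSite 2 L) (TorusSite 2 L) ℂ,
          (1 + Matrix.diagonal (fun p => (w p : ℂ)) * klPairArray L M β U μ K (n - 1) Qm) * N = 1 ∧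
          ∀ k ∈ klBall L μ K, ∀ k' ∈ klBall L μ K,
            ‖klPairAmplitude L M β U μ K n Qm k k' - (klPairArray L M β U μ K (n - 1) Qm * N) k k'‖ ≤
              drivePBar G P U (n - 1) + eremBar G P Q U β L (n - 1))

/-- **(E2″-v2) per-scale VALUE increments of the pair arrays at every total momentum** (what (B1-v2) consumes for total momenta
outside the pair class): at `n ≥ 1`, for all `Q` and all momenta of the ball, `|𝒞_n(Q;k,k') − 𝒞_{n-1}(Q;k,k')| ≤ gainBar` at the
transfers `(Q, k−k', k+k'−Q)` of the pair configuration `(k↑,Q−k↓) → (k'↑,Q−k'↓)` `+ ē_{n-1}` (Lemma E.1/E.3: the two-shell bubbles;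
for `Q` in the pair class the pp gain is the full bubble mass and (E2-v2) is the finer statement). -/
def PairValueIncrementAt (G : GeoConsts) (P : SplitConsts) (Q : EngConsts) (β U μ : ℝ) (K : TrigPolyC4v) (n : ℕ) : Prop :=
  1 ≤ n → ∀ Qm : TorusSite 2 L, ∀ k ∈ klBall L μ K, ∀ k' ∈ klBall L μ K,
    ‖klPairAmplitude L M β U μ K n Qm k k' - klPairAmplitude L M β U μ K (n - 1) Qm k k'‖ ≤
      gainBar G P U n (torusSupNorm (latticeMomentum L Qm 0, latticeMomentum L Qm 1))
          (torusSupNorm (latticeMomentum L (k - k') 0, latticeMomentum L (k - k') 1))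
          (torusSupNorm (latticeMomentum L (k + k' - Qm) 0, latticeMomentum L (k + k' - Qm) 1)) +
        eremBar G P Q U β L (n - 1)

/-- **(E2′-v2) per-scale increments in the fixed-tuple `L¹` norm, at every resolution `m ≥ n`** (what (B2)'s summation on
non-pair-class tuples consumes).  At `n ≥ 1`, for every isotropic (resp. anisotropic) label 4-tuple of resolution `m ≥ n` in
BGM's conservation set and every pinned point: the increment kernel's fixed-tuple `L¹` size is `≤ gainBar` at the tuple's own
transfers `+ ē_{n-1}`; at `n = 0`: the scale-`0` kernel itself is `≤ initL1Bar`. -/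
def TupleIncrementL1At (G : GeoConsts) (P : SplitConsts) (Q : EngConsts) (β U μ : ℝ) (K : TrigPolyC4v) (n : ℕ) : Prop :=
  ∀ m : ℕ, n ≤ m →
    (∀ Ω ∈ bgmSectorSet L M (klIsoFamily L M β μ K klE0 m) 4, ∀ x₁ : SpaceTimeIdx L M,
        fixedTupleL1 L M β 3 (klIsoIncrementKernel L M β U μ K n m) Ω x₁ ≤
          if n = 0 then initL1Bar G P U else
            gainBar G P U n (torusSupNorm (klPPTransfer μ m Ω)) (torusSupNorm (klPHTransferDirect μ m Ω))
                (torusSupNorm (klPHTransferExchange μ m Ω)) + eremBar G P Q U β L (n - 1)) ∧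
    (∀ Ω ∈ bgmSectorSet L M (klAnisoFamily L M β μ K klE0 m) 4, ∀ x₁ : SpaceTimeIdx L M,
        fixedTupleL1 L M β 3 (klAnisoIncrementKernel L M β U μ K n m) Ω x₁ ≤
          if n = 0 then initL1Bar G P U else
            gainBar G P U n (torusSupNorm (klAnisoPPTransfer μ m Ω)) (torusSupNorm (klAnisoPHTransferDirect μ m Ω))
                (torusSupNorm (klAnisoPHTransferExchange μ m Ω)) + eremBar G P Q U β L (n - 1))

/-- **(E5-v2) values ⇒ `L¹` on pair-class tuples** (implication form; what (B2) on pair-class tuples consumes): if the scale-`n`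
pair arrays are bounded by `B ≥ 0` on the ball for EVERY total momentum (the tuple's legs sweep total momenta across `2^{-m}`, well
beyond the pair class), then the fixed-tuple `L¹` size of the scale-`n` quartic kernel on every tuple of resolution `m ≥ n` whose
particle–particle transfer is in the pair class at resolution `n` is `≤ CF·B + CF·(Klam U)²` (off-shell / other-frequency values
cost terms summable sign-blind over the scales above `n`; the resummed ladder is a logarithmic-type multiplier in `Q`, whose
position-space `L¹` norm is bounded by its total variation, i.e. by `sup`). -/
def CooperTupleL1At (G : GeoConsts) (P : SplitConsts) (β U μ : ℝ) (K : TrigPolyC4v) (n : ℕ) : Prop :=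
  ∀ B : ℝ, 0 ≤ B →
    (∀ Qm : TorusSite 2 L, ∀ k ∈ klBall L μ K, ∀ k' ∈ klBall L μ K, ‖klPairAmplitude L M β U μ K n Qm k k'‖ ≤ B) →
      ∀ m : ℕ, n ≤ m →
        (∀ Ω ∈ bgmSectorSet L M (klIsoFamily L M β μ K klE0 m) 4,
            torusSupNorm (klPPTransfer μ m Ω) ≤ ((4 : ℝ) ^ n)⁻¹ → ∀ x₁ : SpaceTimeIdx L M,
              fixedTupleL1 L M β 3 (klIsoKernelAt L M β U μ K n m) Ω x₁ ≤ G.CF * B + G.CF * (P.Klam * U) ^ 2) ∧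
        (∀ Ω ∈ bgmSectorSet L M (klAnisoFamily L M β μ K klE0 m) 4,
            torusSupNorm (klAnisoPPTransfer μ m Ω) ≤ ((4 : ℝ) ^ n)⁻¹ → ∀ x₁ : SpaceTimeIdx L M,
              fixedTupleL1 L M β 3 (klAnisoKernelAt L M β U μ K n m) Ω x₁ ≤ G.CF * B + G.CF * (P.Klam * U) ^ 2)

/-- **`EngineBoundsAtV2 … G P Q K n`** = (E0) ∧ (E1) ∧ (E2-v2) ∧ (E2″-v2) ∧ (E2′-v2) ∧ (E4) ∧ (E5-v2) at scale `h = -n`: what the fermionic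
tree expansion for OUR action delivers at scale `n` from the history below `n` ((E0), (E1), (E4) are v1's `SelfEnergySymmetric`,
`KernelNorms`, `EngineFirstMoments` verbatim).  Same slot type as `Preds.engine`. -/
def EngineBoundsAtV2 (G : GeoConsts) (P : SplitConsts) (Q : EngConsts) (β U μ : ℝ) (K : TrigPolyC4v) (n : ℕ) : Prop :=
  SelfEnergySymmetric L M β U μ K n ∧ KernelNorms L M P Q β U μ K n ∧
    PairLadderStepAt L M G P Q β U μ K n ∧ PairValueIncrementAt L M G P Q β U μ K n ∧ TupleIncrementL1At L M G P Q β U μ K n ∧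
      EngineFirstMoments L M G P Q β U μ K n ∧ CooperTupleL1At L M G P β U μ K n

/-! ## §4 The amended BETA-SPLIT clauses -/

/-- **(B1-v2) the Cooper datum at scale `n`, value level.**  For EVERY total lattice momentum `Q` there is a running s-wave value
`u = u_n(Q) ∈ [0, 2|U|]` with `|𝒞_n(Q;k,k') − u| ≤ C_W·U²` for all momenta of the ball: for `Q` in the pair class at resolution `n`
the repulsive rank-one part is resummed exactly (Sherman–Morrison, denominator `≥ 1` because `U ≥ 0`) and the second-order rest
bounded in the weighted max-entry norm (Neumann, `KLProgrammeCooperResummation.klcr_resummed_entry_le`); for `Q` that left the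
pair class at a resolution `t < n` the datum of scale `t` is frozen by the summable value increments (E2″-v2). -/
def PairArrayAt (P : SplitConsts) (β U μ : ℝ) (K : TrigPolyC4v) (n : ℕ) : Prop :=
  ∀ Qm : TorusSite 2 L,
    ∃ u : ℝ, 0 ≤ u ∧ u ≤ 2 * |U| ∧ ∀ k ∈ klBall L μ K, ∀ k' ∈ klBall L μ K,
      ‖klPairAmplitude L M β U μ K n Qm k k' - (u : ℂ)‖ ≤ P.C_W * U ^ 2

/-- **`BetaSplitAtV2 … G P Q K n`** = (B1-v2) ∧ (B2) ∧ (B4) at scale `h = -n` ((B2) `EndpointNormLine` and (B4) `FirstMoments`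
are v1's verbatim; (B3) is dropped — child 1 re-sums the history's (E2′-v2) increments).  Same slot type as `Preds.split`;
`G`, `Q` are not read. -/
def BetaSplitAtV2 (_G : GeoConsts) (P : SplitConsts) (_Q : EngConsts) (β U μ : ℝ) (K : TrigPolyC4v) (n : ℕ) : Prop :=
  PairArrayAt L M P β U μ K n ∧ EndpointNormLine L M P β U μ K n ∧ FirstMoments L M P β U μ K n

end Model

/-! ## §5 The amended bundle (one def; the glue line `KLRegimeInductionV2 := KLRegimeInductionP klPredsV2` lives downstream) -/

/-- **`klPredsV2 : Preds`** — today's frame / renormalisation / two-leg slots with the amended split and engine slots: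
`{ frameOK := FrameOK, renorm := RenormalisedAt, split := BetaSplitAtV2, engine := EngineBoundsAtV2, twoLeg := TwoLegStep }`.
The children of record become `EngineP klPredsV2 klWindowC`, `BetaSplitP klPredsV2 klWindowC`, `CountertermP klPredsV2 klWindowC`,
`TwoPointAssemblyP klPredsV2 klWindowC` (generic layer `KLProgrammeKLRegimeSplitGeneric`). -/
def klPredsV2 : Preds where
  frameOK := FrameOK
  renorm := fun L M _ _ β U μ K R n => RenormalisedAt L M β U μ K R n
  split := fun L M _ _ G P Q β U μ K n => BetaSplitAtV2 L M G P Q β U μ K n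
  engine := fun L M _ _ G P Q β U μ K n => EngineBoundsAtV2 L M G P Q β U μ K n
  twoLeg := fun L M _ _ G P Q R β U μ K n => TwoLegStep L M G P Q R β U μ K n

/-! ## §6 Bookkeeping lemmas (`rfl`-level) -/

section Model

variable (L M : ℕ) [NeZero L] [NeZero M]

/-- At zero total momentum the pair amplitude is D1's Cooper amplitude. -/
theorem klPairAmplitude_zero (β U μ : ℝ) (K : TrigPolyC4v) (n : ℕ) (k k' : TorusSite 2 L) :
    klPairAmplitude L M β U μ K n 0 k k' = klCooperAmplitude L M β U μ K klE0 n k k' := by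
  simp only [klPairAmplitude, klCooperAmplitude, cooperAmplitude, FreqMomentum.neg, zero_sub]

omit [NeZero M] in
/-- The increment kernel at `n = 0` is the scale-`0` kernel itself. -/
theorem klIsoIncrementKernel_zero (β U μ : ℝ) (K : TrigPolyC4v) (m : ℕ) :
    klIsoIncrementKernel L M β U μ K 0 m = klIsoKernelAt L M β U μ K 0 m := by
  simp [klIsoIncrementKernel, klIsoKernelAt]

omit [NeZero M] in
/-- The increment kernel at `n + 1` is the difference of consecutive kernels (additivity of `sectorisedKernel`). -/
theorem klIsoIncrementKernel_succ (β U μ : ℝ) (K : TrigPolyC4v) (n m : ℕ) :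
    klIsoIncrementKernel L M β U μ K (n + 1) m = klIsoKernelAt L M β U μ K (n + 1) m - klIsoKernelAt L M β U μ K n m := by
  have h : klEffectiveAction L M β U μ K klE0 (n + 1) - klEffectiveAction L M β U μ K klE0 n =
      klEffectiveAction L M β U μ K klE0 (n + 1) + (-1 : ℂ) • klEffectiveAction L M β U μ K klE0 n := by
    rw [neg_one_smul, sub_eq_add_neg]
  unfold klIsoIncrementKernel klIsoKernelAt
  rw [if_neg (Nat.succ_ne_zero n), Nat.add_sub_cancel, h, sectorisedKernel_add, sectorisedKernel_smul, neg_one_smul,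
    sub_eq_add_neg]

omit [NeZero M] in
/-- At its own resolution the scale-`n` kernel is D1's `klLegKernel … n 4`. -/
theorem klIsoKernelAt_self (β U μ : ℝ) (K : TrigPolyC4v) (n : ℕ) :
    klIsoKernelAt L M β U μ K n n = klLegKernel L M β U μ K klE0 n 4 := rfl

omit [NeZero M] in
/-- At its own resolution the anisotropic scale-`n` kernel is D1's `klAnisoLegKernel … n 4`. -/
theorem klAnisoKernelAt_self (β U μ : ℝ) (K : TrigPolyC4v) (n : ℕ) :
    klAnisoKernelAt L M β U μ K n n = klAnisoLegKernel L M β U μ K klE0 n 4 := rfl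

end Model

end Summit.HubbardSuperconductivity.HubbardSuperconductivity.Theorems.KLRegimeSplit

end
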